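import Summits.QuantumFields.YangMills.Theorems.SwapVirialDeficitZeroModeGroupThreeLaplaceRateAlgebra
import HarnessLib

/-!
# Exact zero-mode rung on the GROUP, three letters, Laplace form — VII: the weighted dominator of the rate term `Δ₁` and its integral
# (free-hands support of ⟨stmt-QuantumFields-24197⟩; quantifies w2 g55's chain I–V toward `|β²Λ₃(β) − v₃| ≤ K·β^{−θ}`)

Part VI (✓`hsc_le_hsc_zero_add`/✓`hsc_zero_le_hsc_add`) bounded `|h_s − h_0|` by `Δ₁ + Δ₂`, `Δ₁ = 𝟙𝟙·e^{−gexp}(sR)^θ`,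
`R = 20(1+|w|²)³/(N_0(x)²N_0(y)²)`.  Here `∫∫ Δ₁ ≤ C·s^θ·(r²)^{−(4/3+6θ)}` in the pair frame of ✓`pairCoord` by the template of ✓`lintegral_Fdom_le`:
§1 ★ `add_rpow_mul_exp_neg_le` — the moment cost `(1+t)^p e^{−2r²t} ≤ 2(r²)^{−p}` (`0 < p ≤ 1`, `0 < r² ≤ 1`; from `e^x ≥ x`);
§2 ★ `weighted_gq_le` — half the transverse Gaussian pays the weight: `(1+|w|²)^p·g_r(q,w) ≤ 2(r²)^{−p}·g_{r/√2}(q,w)`, and the exact coupled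
Gaussian of ✓`lintegral_gq` at `r/√2` is `≤ 4×` the one at `r` (`lintegral_gqW_sq_le`); §3 the separable majorant `rateΦA` of `Δ₁` (longitudinal weights
`(x₀²)^{−2θ}(y₀²)^{−2θ} ≥ N_0^{−2θ}`), ★ `rateΔ₁_le_rateΦA`; §4 ★ `lintegral_rateΦA_inner_le` (the transverse block, reused by part VIII) and
★★ `lintegral_rateΔ₁_le`: `∫∫ Δ₁ ≤ s^θ20^θ·I(2θ)²·16(r²)^{−6θ}·(π²/48)(r²)^{−4/3}·I(1/3)²` (`0 < θ`, `3θ ≤ 1`; finite when `4θ < 1`).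
HONEST LABEL: finite-dimensional real analysis (plan-level zero-mode rung of a DRAFT line «sharp-sigma»); NOT the fixed-`L` sharp law, NOT ⟨24197⟩;
the Yang–Mills mass gap is NOT proved; no summit is proved by a line.  Width seat ym-line-sfw-p2-w2 g56 (cell ym-idea-1, free hands; own crux
⟨22884⟩ blocked-on ⟨19935⟩), `--supports stmt-QuantumFields-24197`.  Standard axioms, 0 `sorry`.  References: [cite: GonzalezarroyoAltes1988];
[cite: Vanbaal2001]; [folklore].
-/

set_option autoImplicit false

noncomputable section

open MeasureTheory Quaternion Set Filter Topology
open scoped Quaternion ENNReal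
open Literature.MathematicalPhysics.QuantumLattice
open Summit.QuantumFields.YangMills.Theorems.SwapTwistDeficit.ToronLog

attribute [local instance] Literature.Analysis.FluidPDE.Tao2016.quatMeasurableSpace
  Literature.Analysis.FluidPDE.Tao2016.quatBorelSpace
  Literature.MathematicalPhysics.QuantumLattice.secondCountableTopology_su2

namespace Summit.QuantumFields.YangMills.Theorems.SwapVirialDeficit.ZeroModeGroup

/-! ## §1 The moment cost of a polynomial weight against a Gaussian of strength `2r²` -/

/-- `t^p e^{−ct} ≤ (p/c)^p` for `t ≥ 0`, `c > 0`, `0 < p` (from `e^x ≥ x` at `x = (c/p)t`). [folklore] -/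
theorem rpow_mul_exp_neg_le {t c p : ℝ} (ht : 0 ≤ t) (hc : 0 < c) (hp : 0 < p) : t ^ p * Real.exp (-(c * t)) ≤ (p / c) ^ p := by
  have h1 : t * Real.exp (-(c / p * t)) ≤ p / c := by
    have hx : c / p * t ≤ Real.exp (c / p * t) := by linarith [Real.add_one_le_exp (c / p * t)]
    rw [Real.exp_neg]
    have hE : 0 < Real.exp (c / p * t) := Real.exp_pos _
    rw [mul_inv_le_iff₀ hE]
    calc t = p / c * (c / p * t) := by field_simp
      _ ≤ p / c * Real.exp (c / p * t) := mul_le_mul_of_nonneg_left hx (by positivity)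
  have h2 : (t * Real.exp (-(c / p * t))) ^ p = t ^ p * Real.exp (-(c * t)) := by
    rw [Real.mul_rpow ht (Real.exp_pos _).le, ← Real.exp_mul]
    congr 2; field_simp
  rw [← h2]
  exact Real.rpow_le_rpow (by positivity) h1 hp.le

/-- ★ **Moment cost**: `(1+t)^p e^{−2r²t} ≤ 2(r²)^{−p}` for `t ≥ 0`, `0 < r² ≤ 1`, `0 < p ≤ 1`. [folklore] -/
theorem add_rpow_mul_exp_neg_le {t r p : ℝ} (ht : 0 ≤ t) (hr : 0 < r) (hr1 : r ^ 2 ≤ 1) (hp : 0 < p) (hp1 : p ≤ 1) :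
    (1 + t) ^ p * Real.exp (-(2 * r ^ 2 * t)) ≤ 2 * (r ^ 2) ^ (-p) := by
  have hr2 : 0 < r ^ 2 := by positivity
  have hsub : (1 + t) ^ p ≤ 1 + t ^ p := by
    have h := Real.rpow_add_le_add_rpow zero_le_one ht hp.le hp1
    rwa [Real.one_rpow] at h
  have hE1 : Real.exp (-(2 * r ^ 2 * t)) ≤ 1 := Real.exp_le_one_iff.2 (by nlinarith)
  have hE0 : 0 < Real.exp (-(2 * r ^ 2 * t)) := Real.exp_pos _
  have hmom : t ^ p * Real.exp (-(2 * r ^ 2 * t)) ≤ (r ^ 2) ^ (-p) := by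
    have h := rpow_mul_exp_neg_le ht (by positivity : 0 < 2 * r ^ 2) hp
    have e : -(2 * r ^ 2 * t) = -((2 * r ^ 2) * t) := by ring
    rw [e]
    refine h.trans ?_
    rw [Real.rpow_neg hr2.le, ← Real.inv_rpow hr2.le]
    refine Real.rpow_le_rpow (by positivity) ?_ hp.le
    rw [div_le_iff₀ (by positivity : (0:ℝ) < 2 * r ^ 2), inv_mul_eq_div, le_div_iff₀ hr2]
    nlinarith
  have hone : 1 ≤ (r ^ 2) ^ (-p) := Real.one_le_rpow_of_pos_of_le_one_of_nonpos hr2 hr1 (by linarith)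
  calc (1 + t) ^ p * Real.exp (-(2 * r ^ 2 * t)) ≤ (1 + t ^ p) * Real.exp (-(2 * r ^ 2 * t)) :=
        mul_le_mul_of_nonneg_right hsub hE0.le
    _ = Real.exp (-(2 * r ^ 2 * t)) + t ^ p * Real.exp (-(2 * r ^ 2 * t)) := by ring
    _ ≤ 1 + (r ^ 2) ^ (-p) := add_le_add hE1 hmom
    _ ≤ 2 * (r ^ 2) ^ (-p) := by linarith

/-! ## §2 Half the transverse Gaussian pays the weight -/

/-- `(r/√2)² = r²/2`. [folklore] -/
theorem sq_div_sqrt_two (r : ℝ) : (r / Real.sqrt 2) ^ 2 = r ^ 2 / 2 := by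
  rw [div_pow, Real.sq_sqrt (by norm_num : (0:ℝ) ≤ 2)]

/-- The exponent of `g_r` splits off `2r²|w|²`: `Q_r(q,w) = 2r²(w₁²+w₂²) + Q_{r/√2}(q,w)`. [folklore] -/
theorem gq_exponent_split (r : ℝ) (q w : ℝ × ℝ) :
    4 * (r ^ 2 + q.2 ^ 2) * w.1 ^ 2 + 2 * (-(4 * q.1 * q.2)) * w.1 * w.2 + 4 * (r ^ 2 + q.1 ^ 2) * w.2 ^ 2 =
      2 * r ^ 2 * (w.1 ^ 2 + w.2 ^ 2) + (4 * ((r / Real.sqrt 2) ^ 2 + q.2 ^ 2) * w.1 ^ 2 + 2 * (-(4 * q.1 * q.2)) * w.1 * w.2 +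
        4 * ((r / Real.sqrt 2) ^ 2 + q.1 ^ 2) * w.2 ^ 2) := by
  rw [sq_div_sqrt_two]; ring

/-- ★ **Weighted transverse Gaussian**: `(1+|w|²)^p·g_r(q,w) ≤ 2(r²)^{−p}·g_{r/√2}(q,w)` (`0 < r² ≤ 1`, `0 < p ≤ 1`). [folklore] -/
theorem weighted_gq_le {r p : ℝ} (hr : 0 < r) (hr1 : r ^ 2 ≤ 1) (hp : 0 < p) (hp1 : p ≤ 1) (q w : ℝ × ℝ) :
    ENNReal.ofReal ((1 + (w.1 ^ 2 + w.2 ^ 2)) ^ p) * gq r q w ≤ ENNReal.ofReal (2 * (r ^ 2) ^ (-p)) * gq (r / Real.sqrt 2) q w := by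
  rw [gq_def, gq_def, ← ENNReal.ofReal_mul (Real.rpow_nonneg (by positivity) _), ← ENNReal.ofReal_mul (by positivity)]
  refine ENNReal.ofReal_le_ofReal ?_
  rw [gq_exponent_split r q w, neg_add, Real.exp_add, ← mul_assoc]
  refine mul_le_mul_of_nonneg_right ?_ (Real.exp_pos _).le
  exact add_rpow_mul_exp_neg_le (by positivity) hr hr1 hp hp1

/-- The weighted transverse factor `(1+|w|²)^p·g_r(q,w)` (as `ℝ≥0∞`). [folklore] -/
def gqW (p r : ℝ) (q w : ℝ × ℝ) : ℝ≥0∞ := ENNReal.ofReal ((1 + (w.1 ^ 2 + w.2 ^ 2)) ^ p) * gq r q w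

/-- Unfolding `gqW`. [folklore] -/
theorem gqW_def (p r : ℝ) (q w : ℝ × ℝ) : gqW p r q w = ENNReal.ofReal ((1 + (w.1 ^ 2 + w.2 ^ 2)) ^ p) * gq r q w := rfl

/-- `gqW` is jointly measurable. [folklore] -/
theorem measurable_gqW (p r : ℝ) : Measurable fun v : (ℝ × ℝ) × (ℝ × ℝ) => gqW p r v.1 v.2 := by
  unfold gqW
  exact (ENNReal.measurable_ofReal.comp ((by fun_prop : Measurable fun v : (ℝ × ℝ) × (ℝ × ℝ) =>
    1 + (v.2.1 ^ 2 + v.2.2 ^ 2)).pow_const _)).mul (measurable_gq r)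

/-- `gqW p r q ·` is measurable. [folklore] -/
theorem measurable_gqW_right (p r : ℝ) (q : ℝ × ℝ) : Measurable (gqW p r q) := by
  have : Measurable fun w : ℝ × ℝ => gqW p r q w := by
    unfold gqW
    exact (ENNReal.measurable_ofReal.comp ((by fun_prop : Measurable fun w : ℝ × ℝ => 1 + (w.1 ^ 2 + w.2 ^ 2)).pow_const _)).mul
      (measurable_gq_right r q)
  exact this

attribute [irreducible] gqW

/-- ★ `∫ (1+|w|²)^p g_r(q,w) dw ≤ 2(r²)^{−p}·π/√(16(r²/2)((r²/2)+|q|²))`. [folklore] -/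
theorem lintegral_gqW_le {r p : ℝ} (hr : 0 < r) (hr1 : r ^ 2 ≤ 1) (hp : 0 < p) (hp1 : p ≤ 1) (q : ℝ × ℝ) :
    ∫⁻ w, gqW p r q w ≤ ENNReal.ofReal (2 * (r ^ 2) ^ (-p)) *
      ENNReal.ofReal (Real.pi / Real.sqrt (16 * (r / Real.sqrt 2) ^ 2 * ((r / Real.sqrt 2) ^ 2 + q.1 ^ 2 + q.2 ^ 2))) := by
  have hr' : 0 < r / Real.sqrt 2 := by positivity
  calc ∫⁻ w, gqW p r q w ≤ ∫⁻ w, ENNReal.ofReal (2 * (r ^ 2) ^ (-p)) * gq (r / Real.sqrt 2) q w :=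
        lintegral_mono fun w => by rw [gqW_def]; exact weighted_gq_le hr hr1 hp hp1 q w
    _ = _ := by rw [lintegral_const_mul _ (measurable_gq_right _ q), lintegral_gq hr' q]

/-- ★ The square of the weighted transverse integral: `(∫ gqW)² ≤ 4(r²)^{−2p}·4·π²/(16r²(r²+|q|²))` — the coupled Gaussian at `r/√2` is at most
`4×` the one at `r`. [folklore] -/
theorem lintegral_gqW_sq_le {r p : ℝ} (hr : 0 < r) (hr1 : r ^ 2 ≤ 1) (hp : 0 < p) (hp1 : p ≤ 1) (q : ℝ × ℝ) :
    (∫⁻ w, gqW p r q w) * (∫⁻ w, gqW p r q w) ≤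
      ENNReal.ofReal (16 * ((r ^ 2) ^ (-p)) ^ 2) * ENNReal.ofReal (Real.pi ^ 2 / (16 * r ^ 2 * (r ^ 2 + q.1 ^ 2 + q.2 ^ 2))) := by
  have hr' : 0 < r / Real.sqrt 2 := by positivity
  have h1 := lintegral_gqW_le hr hr1 hp hp1 q
  have hK : 0 ≤ 2 * (r ^ 2) ^ (-p) := by positivity
  calc (∫⁻ w, gqW p r q w) * (∫⁻ w, gqW p r q w)
      ≤ (ENNReal.ofReal (2 * (r ^ 2) ^ (-p)) * ENNReal.ofReal (Real.pi / Real.sqrt (16 * (r / Real.sqrt 2) ^ 2 *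
          ((r / Real.sqrt 2) ^ 2 + q.1 ^ 2 + q.2 ^ 2)))) *
        (ENNReal.ofReal (2 * (r ^ 2) ^ (-p)) * ENNReal.ofReal (Real.pi / Real.sqrt (16 * (r / Real.sqrt 2) ^ 2 *
          ((r / Real.sqrt 2) ^ 2 + q.1 ^ 2 + q.2 ^ 2)))) := mul_le_mul' h1 h1
    _ = ENNReal.ofReal (2 * (r ^ 2) ^ (-p)) * ENNReal.ofReal (2 * (r ^ 2) ^ (-p)) *
        ((∫⁻ w, gq (r / Real.sqrt 2) q w) * (∫⁻ w, gq (r / Real.sqrt 2) q w)) := by rw [lintegral_gq hr' q]; ring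
    _ = ENNReal.ofReal (2 * (r ^ 2) ^ (-p)) * ENNReal.ofReal (2 * (r ^ 2) ^ (-p)) *
        ENNReal.ofReal (Real.pi ^ 2 / (16 * (r / Real.sqrt 2) ^ 2 * ((r / Real.sqrt 2) ^ 2 + q.1 ^ 2 + q.2 ^ 2))) := by
          rw [lintegral_gq_mul_self hr' q]
    _ ≤ _ := by
          rw [← ENNReal.ofReal_mul hK, ← ENNReal.ofReal_mul (by positivity), ← ENNReal.ofReal_mul (by positivity)]
          refine ENNReal.ofReal_le_ofReal ?_
          have hq : 0 ≤ q.1 ^ 2 + q.2 ^ 2 := by positivity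
          have hden' : 0 < 16 * r ^ 2 * (r ^ 2 + q.1 ^ 2 + q.2 ^ 2) := by positivity
          have hcmp : Real.pi ^ 2 / (16 * (r / Real.sqrt 2) ^ 2 * ((r / Real.sqrt 2) ^ 2 + q.1 ^ 2 + q.2 ^ 2)) ≤
              4 * (Real.pi ^ 2 / (16 * r ^ 2 * (r ^ 2 + q.1 ^ 2 + q.2 ^ 2))) := by
            have hcmp' : 16 * r ^ 2 * (r ^ 2 + q.1 ^ 2 + q.2 ^ 2) ≤ 4 * (16 * (r / Real.sqrt 2) ^ 2 * ((r / Real.sqrt 2) ^ 2 + q.1 ^ 2 + q.2 ^ 2)) := by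
              rw [sq_div_sqrt_two]; nlinarith [mul_nonneg (sq_nonneg r) hq]
            calc Real.pi ^ 2 / (16 * (r / Real.sqrt 2) ^ 2 * ((r / Real.sqrt 2) ^ 2 + q.1 ^ 2 + q.2 ^ 2))
                = 4 * Real.pi ^ 2 / (4 * (16 * (r / Real.sqrt 2) ^ 2 * ((r / Real.sqrt 2) ^ 2 + q.1 ^ 2 + q.2 ^ 2))) :=
                  (mul_div_mul_left _ _ (by norm_num : (4:ℝ) ≠ 0)).symm
              _ ≤ 4 * Real.pi ^ 2 / (16 * r ^ 2 * (r ^ 2 + q.1 ^ 2 + q.2 ^ 2)) := div_le_div_of_nonneg_left (by positivity) hden' hcmp'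
              _ = 4 * (Real.pi ^ 2 / (16 * r ^ 2 * (r ^ 2 + q.1 ^ 2 + q.2 ^ 2))) := by ring
          have hw : 0 ≤ (r ^ 2) ^ (-p) := by positivity
          calc 2 * (r ^ 2) ^ (-p) * (2 * (r ^ 2) ^ (-p)) * (Real.pi ^ 2 / (16 * (r / Real.sqrt 2) ^ 2 * ((r / Real.sqrt 2) ^ 2 + q.1 ^ 2 + q.2 ^ 2)))
              ≤ 2 * (r ^ 2) ^ (-p) * (2 * (r ^ 2) ^ (-p)) * (4 * (Real.pi ^ 2 / (16 * r ^ 2 * (r ^ 2 + q.1 ^ 2 + q.2 ^ 2)))) :=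
                mul_le_mul_of_nonneg_left hcmp (by positivity)
            _ = 16 * ((r ^ 2) ^ (-p)) ^ 2 * (Real.pi ^ 2 / (16 * r ^ 2 * (r ^ 2 + q.1 ^ 2 + q.2 ^ 2))) := by ring

/-! ## §3 The separable majorant of `Δ₁` in the pair frame -/

/-- The boxed longitudinal weight `ι_c(t) = 𝟙{t² < 1}·(t²)^{−c}` (`⊤` at `t = 0`). [folklore] -/
def boxSing (c : ℝ) (t : ℝ) : ℝ≥0∞ := {u : ℝ | u ^ 2 < 1}.indicator (singPow c) t

/-- Unfolding `boxSing`. [folklore] -/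
theorem boxSing_def (c t : ℝ) : boxSing c t = {u : ℝ | u ^ 2 < 1}.indicator (singPow c) t := rfl

/-- The separable majorant `rateΦA` of the rate term `Δ₁` in the pair frame `((x₀,y₀),((x_I,y_I),((x_J,y_J),(x_K,y_K))))`:
`s^θ20^θ · ι_{2θ}(x₀)ι_{2θ}(y₀) · 𝟙_{box}(q)·gqW(q,w_J)·gqW(q,w_K)`. [folklore] -/
def rateΦA (s θ r : ℝ) (w : (ℝ × ℝ) × ((ℝ × ℝ) × ((ℝ × ℝ) × (ℝ × ℝ)))) : ℝ≥0∞ :=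
  ENNReal.ofReal (s ^ θ * 20 ^ θ) * ((boxSing (2 * θ) w.1.1 * boxSing (2 * θ) w.1.2) *
    (sqBox.indicator (fun _ => (1 : ℝ≥0∞)) w.2.1 * (gqW (3 * θ) r w.2.1 w.2.2.1 * gqW (3 * θ) r w.2.1 w.2.2.2)))

/-- The inner `(q, w_J, w_K)` factor of `rateΦA` is measurable. [folklore] -/
theorem measurable_rateΦA_inner (θ r : ℝ) : Measurable fun u : (ℝ × ℝ) × ((ℝ × ℝ) × (ℝ × ℝ)) =>
    sqBox.indicator (fun _ => (1 : ℝ≥0∞)) u.1 * (gqW (3 * θ) r u.1 u.2.1 * gqW (3 * θ) r u.1 u.2.2) := by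
  have hi : Measurable fun p : ℝ × ℝ => sqBox.indicator (fun _ => (1 : ℝ≥0∞)) p := measurable_const.indicator measurableSet_sqBox
  have h1 : Measurable fun u : (ℝ × ℝ) × ((ℝ × ℝ) × (ℝ × ℝ)) => gqW (3 * θ) r u.1 u.2.1 :=
    (measurable_gqW _ r).comp (measurable_fst.prodMk (measurable_fst.comp measurable_snd))
  have h2 : Measurable fun u : (ℝ × ℝ) × ((ℝ × ℝ) × (ℝ × ℝ)) => gqW (3 * θ) r u.1 u.2.2 :=
    (measurable_gqW _ r).comp (measurable_fst.prodMk (measurable_snd.comp measurable_snd))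
  exact (hi.comp measurable_fst).mul (h1.mul h2)

/-- The longitudinal `(x₀, y₀)` factor of `rateΦA` is measurable. [folklore] -/
theorem measurable_rateΦA_long (θ : ℝ) : Measurable fun p : ℝ × ℝ => boxSing (2 * θ) p.1 * boxSing (2 * θ) p.2 :=
  ((measurable_boxSing _).comp measurable_fst).mul ((measurable_boxSing _).comp measurable_snd)

/-- `rateΦA` is measurable. [folklore] -/
theorem measurable_rateΦA (s θ r : ℝ) : Measurable (rateΦA s θ r) := by
  unfold rateΦA
  exact (((measurable_rateΦA_long θ).comp measurable_fst).mul ((measurable_rateΦA_inner θ r).comp measurable_snd)).const_mul _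

/-- The weight algebra: inside `{N_0(x) < 1, N_0(y) < 1}` with `x₀, y₀ ≠ 0`,
`e^{−gexp}(sR)^θ ≤ s^θ20^θ·(x₀²)^{−2θ}(y₀²)^{−2θ}·(1+|w_J|²)^{3θ}g_r(q,w_J)·(1+|w_K|²)^{3θ}g_r(q,w_K)` (as reals). [folklore] -/
theorem exp_gexp_mul_rpow_le {s θ r : ℝ} (hs : 0 ≤ s) (hθ : 0 ≤ θ) {x y : ℍ} (hx0 : x.re ≠ 0) (hy0 : y.re ≠ 0) :
    Real.exp (-(gexp r x y)) * (s * rateR x y) ^ θ ≤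
      s ^ θ * 20 ^ θ * ((x.re ^ 2) ^ (-(2 * θ)) * (y.re ^ 2) ^ (-(2 * θ))) *
        (((1 + (x.imJ ^ 2 + y.imJ ^ 2)) ^ (3 * θ) *
            Real.exp (-(4 * (r ^ 2 + y.imI ^ 2) * x.imJ ^ 2 + 2 * (-(4 * x.imI * y.imI)) * x.imJ * y.imJ + 4 * (r ^ 2 + x.imI ^ 2) * y.imJ ^ 2))) *
          ((1 + (x.imK ^ 2 + y.imK ^ 2)) ^ (3 * θ) *
            Real.exp (-(4 * (r ^ 2 + y.imI ^ 2) * x.imK ^ 2 + 2 * (-(4 * x.imI * y.imI)) * x.imK * y.imK + 4 * (r ^ 2 + x.imI ^ 2) * y.imK ^ 2)))) := by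
  -- the exponential identity
  have hexp : Real.exp (-(gexp r x y)) =
      Real.exp (-(4 * (r ^ 2 + y.imI ^ 2) * x.imJ ^ 2 + 2 * (-(4 * x.imI * y.imI)) * x.imJ * y.imJ + 4 * (r ^ 2 + x.imI ^ 2) * y.imJ ^ 2)) *
        Real.exp (-(4 * (r ^ 2 + y.imI ^ 2) * x.imK ^ 2 + 2 * (-(4 * x.imI * y.imI)) * x.imK * y.imK + 4 * (r ^ 2 + x.imI ^ 2) * y.imK ^ 2)) := by
    rw [← Real.exp_add, gexp_def]; congr 1; ring
  -- the weight
  set a : ℝ := x.re ^ 2 + x.imI ^ 2 with ha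
  set b : ℝ := y.re ^ 2 + y.imI ^ 2 with hb
  set σ : ℝ := x.imJ ^ 2 + x.imK ^ 2 + y.imJ ^ 2 + y.imK ^ 2 with hσ
  have hx2 : 0 < x.re ^ 2 := by positivity
  have hy2 : 0 < y.re ^ 2 := by positivity
  have ha0 : 0 < a := by rw [ha]; nlinarith [sq_nonneg x.imI]
  have hb0 : 0 < b := by rw [hb]; nlinarith [sq_nonneg y.imI]
  have hσ0 : 0 ≤ σ := by positivity
  have hR : rateR x y = 20 * (1 + σ) ^ 3 / (a ^ 2 * b ^ 2) := by rw [rateR_def]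
  have hRθ : (s * rateR x y) ^ θ = s ^ θ * 20 ^ θ * (((1 + σ) ^ 3) ^ θ * ((a ^ 2) ^ (-θ) * (b ^ 2) ^ (-θ))) := by
    rw [hR, Real.mul_rpow hs (by positivity), Real.div_rpow (by positivity) (by positivity), Real.mul_rpow (by norm_num) (by positivity),
      Real.mul_rpow (by positivity) (by positivity), Real.rpow_neg (by positivity), Real.rpow_neg (by positivity)]
    field_simp
  -- `((1+σ)³)^θ ≤ (1+|w_J|²)^{3θ}(1+|w_K|²)^{3θ}`
  have hσle : ((1 + σ) ^ 3) ^ θ ≤ (1 + (x.imJ ^ 2 + y.imJ ^ 2)) ^ (3 * θ) * (1 + (x.imK ^ 2 + y.imK ^ 2)) ^ (3 * θ) := by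
    rw [← Real.mul_rpow (by positivity) (by positivity), ← Real.rpow_natCast _ 3, ← Real.rpow_mul (by positivity)]
    push_cast
    refine Real.rpow_le_rpow (by positivity) ?_ (by positivity)
    rw [hσ]; nlinarith [mul_nonneg (add_nonneg (sq_nonneg x.imJ) (sq_nonneg y.imJ)) (add_nonneg (sq_nonneg x.imK) (sq_nonneg y.imK))]
  -- `(a²)^{−θ} ≤ (x₀²)^{−2θ}`
  have hal : (a ^ 2) ^ (-θ) ≤ (x.re ^ 2) ^ (-(2 * θ)) := by
    have h1 : (a ^ 2) ^ (-θ) ≤ ((x.re ^ 2) ^ 2) ^ (-θ) :=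
      Real.rpow_le_rpow_of_nonpos (by positivity) (by rw [ha]; nlinarith [sq_nonneg x.imI, sq_nonneg x.re]) (by linarith)
    refine h1.trans (le_of_eq ?_)
    rw [← Real.rpow_natCast_mul hx2.le]; congr 1; push_cast; ring
  have hbl : (b ^ 2) ^ (-θ) ≤ (y.re ^ 2) ^ (-(2 * θ)) := by
    have h1 : (b ^ 2) ^ (-θ) ≤ ((y.re ^ 2) ^ 2) ^ (-θ) :=
      Real.rpow_le_rpow_of_nonpos (by positivity) (by rw [hb]; nlinarith [sq_nonneg y.imI, sq_nonneg y.re]) (by linarith)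
    refine h1.trans (le_of_eq ?_)
    rw [← Real.rpow_natCast_mul hy2.le]; congr 1; push_cast; ring
  rw [hexp, hRθ]
  set EJ := Real.exp (-(4 * (r ^ 2 + y.imI ^ 2) * x.imJ ^ 2 + 2 * (-(4 * x.imI * y.imI)) * x.imJ * y.imJ + 4 * (r ^ 2 + x.imI ^ 2) * y.imJ ^ 2))
  set EK := Real.exp (-(4 * (r ^ 2 + y.imI ^ 2) * x.imK ^ 2 + 2 * (-(4 * x.imI * y.imI)) * x.imK * y.imK + 4 * (r ^ 2 + x.imI ^ 2) * y.imK ^ 2))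
  have hprod : ((1 + σ) ^ 3) ^ θ * ((a ^ 2) ^ (-θ) * (b ^ 2) ^ (-θ)) ≤
      ((1 + (x.imJ ^ 2 + y.imJ ^ 2)) ^ (3 * θ) * (1 + (x.imK ^ 2 + y.imK ^ 2)) ^ (3 * θ)) * ((x.re ^ 2) ^ (-(2 * θ)) * (y.re ^ 2) ^ (-(2 * θ))) :=
    mul_le_mul hσle (mul_le_mul hal hbl (by positivity) (by positivity)) (by positivity) (by positivity)
  have hst : 0 ≤ s ^ θ * 20 ^ θ := by positivity
  calc EJ * EK * (s ^ θ * 20 ^ θ * (((1 + σ) ^ 3) ^ θ * ((a ^ 2) ^ (-θ) * (b ^ 2) ^ (-θ))))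
      ≤ EJ * EK * (s ^ θ * 20 ^ θ * (((1 + (x.imJ ^ 2 + y.imJ ^ 2)) ^ (3 * θ) * (1 + (x.imK ^ 2 + y.imK ^ 2)) ^ (3 * θ)) *
          ((x.re ^ 2) ^ (-(2 * θ)) * (y.re ^ 2) ^ (-(2 * θ))))) :=
        mul_le_mul_of_nonneg_left (mul_le_mul_of_nonneg_left hprod hst) (by positivity)
    _ = _ := by ring

/-- ★ **`Δ₁ ≤ rateΦA ∘ pairCoord`** (for `0 ≤ s`, `0 ≤ θ`). [folklore] -/
theorem rateΔ₁_le_rateΦA {s θ : ℝ} (hs : 0 ≤ s) (hθ : 0 ≤ θ) (r : ℝ) (z : ℍ × ℍ) : rateΔ₁ s θ r z.1 z.2 ≤ rateΦA s θ r (pairCoord z) := by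
  rw [rateΔ₁_def]
  by_cases hx : z.1.re ^ 2 + z.1.imI ^ 2 < 1
  swap
  · rw [indicator_of_notMem (show z.1 ∉ {x : ℍ | x.re ^ 2 + x.imI ^ 2 < 1} from hx), zero_mul, zero_mul]; exact bot_le
  by_cases hy : z.2.re ^ 2 + z.2.imI ^ 2 < 1
  swap
  · rw [indicator_of_notMem (show z.2 ∉ {y : ℍ | y.re ^ 2 + y.imI ^ 2 < 1} from hy), mul_zero, zero_mul]; exact bot_le
  rw [indicator_of_mem (show z.1 ∈ {x : ℍ | x.re ^ 2 + x.imI ^ 2 < 1} from hx),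
    indicator_of_mem (show z.2 ∈ {y : ℍ | y.re ^ 2 + y.imI ^ 2 < 1} from hy), one_mul, one_mul]
  have h0 : z.1.re ∈ {u : ℝ | u ^ 2 < 1} := by show z.1.re ^ 2 < 1; nlinarith [sq_nonneg z.1.imI]
  have h0' : z.2.re ∈ {u : ℝ | u ^ 2 < 1} := by show z.2.re ^ 2 < 1; nlinarith [sq_nonneg z.2.imI]
  have hI : (z.1.imI, z.2.imI) ∈ sqBox :=
    ⟨by show z.1.imI ^ 2 < 1; nlinarith [sq_nonneg z.1.re], by show z.2.imI ^ 2 < 1; nlinarith [sq_nonneg z.2.re]⟩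
  unfold rateΦA
  rw [show (pairCoord z).1 = (z.1.re, z.2.re) from rfl, show (pairCoord z).2.1 = (z.1.imI, z.2.imI) from rfl,
    show (pairCoord z).2.2.1 = (z.1.imJ, z.2.imJ) from rfl, show (pairCoord z).2.2.2 = (z.1.imK, z.2.imK) from rfl,
    indicator_of_mem hI, one_mul, boxSing_def, boxSing_def, indicator_of_mem h0, indicator_of_mem h0']
  have hC : ENNReal.ofReal (s ^ θ * 20 ^ θ) * ((singPow (2 * θ) z.1.re * singPow (2 * θ) z.2.re) *
      (gqW (3 * θ) r (z.1.imI, z.2.imI) (z.1.imJ, z.2.imJ) * gqW (3 * θ) r (z.1.imI, z.2.imI) (z.1.imK, z.2.imK))) =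
      (singPow (2 * θ) z.1.re * singPow (2 * θ) z.2.re) * (ENNReal.ofReal (s ^ θ * 20 ^ θ) *
      (gqW (3 * θ) r (z.1.imI, z.2.imI) (z.1.imJ, z.2.imJ) * gqW (3 * θ) r (z.1.imI, z.2.imI) (z.1.imK, z.2.imK))) := by ring
  by_cases hs0 : s ^ θ * 20 ^ θ = 0
  · -- degenerate `s = 0` (then `θ > 0`): both sides vanish or the bound is trivial
    have hθ0 : θ ≠ 0 := by
      intro h; rw [h, Real.rpow_zero, Real.rpow_zero] at hs0; norm_num at hs0
    have hs00 : s ^ θ = 0 := by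
      rcases mul_eq_zero.1 hs0 with h | h
      · exact h
      · exact absurd h (Real.rpow_pos_of_pos (by norm_num) θ).ne'
    have : (s * rateR z.1 z.2) ^ θ = 0 := by
      rw [Real.mul_rpow hs (rateR_nonneg _ _), hs00, zero_mul]
    rw [this, mul_zero, ENNReal.ofReal_zero]; exact bot_le
  have hCne : ENNReal.ofReal (s ^ θ * 20 ^ θ) * (gqW (3 * θ) r (z.1.imI, z.2.imI) (z.1.imJ, z.2.imJ) *
      gqW (3 * θ) r (z.1.imI, z.2.imI) (z.1.imK, z.2.imK)) ≠ 0 := by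
    refine mul_ne_zero ((ENNReal.ofReal_pos.2 (lt_of_le_of_ne (by positivity) (Ne.symm hs0))).ne') (mul_ne_zero ?_ ?_) <;>
    · rw [gqW_def, gq_def]
      exact mul_ne_zero (ENNReal.ofReal_pos.2 (Real.rpow_pos_of_pos (by positivity) _)).ne' (ENNReal.ofReal_pos.2 (Real.exp_pos _)).ne'
  rw [hC]
  by_cases z1 : z.1.re = 0
  · rw [z1, singPow_zero, ENNReal.top_mul (singPow_ne_zero _ _), ENNReal.top_mul hCne]; exact le_top
  by_cases z2 : z.2.re = 0
  · rw [z2, singPow_zero, ENNReal.mul_top (singPow_ne_zero _ _), ENNReal.top_mul hCne]; exact le_top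
  rw [singPow_of_ne z1, singPow_of_ne z2, gqW_def, gqW_def, gq_def, gq_def]
  dsimp only
  rw [← ENNReal.ofReal_mul (by positivity), ← ENNReal.ofReal_mul (by positivity), ← ENNReal.ofReal_mul (by positivity),
    ← ENNReal.ofReal_mul (by positivity), ← ENNReal.ofReal_mul (by positivity), ← ENNReal.ofReal_mul (by positivity)]
  refine ENNReal.ofReal_le_ofReal ((exp_gexp_mul_rpow_le (r := r) hs hθ z1 z2).trans (le_of_eq ?_))
  ring

/-! ## §4 The integral of `rateΦA` and of `Δ₁` -/

/-- ★ **The transverse block**: `∫ 𝟙_{box}(q)·gqW(q,w_J)·gqW(q,w_K) d(q,w_J,w_K) ≤ 16(r²)^{−2p}·(π²/48)(r²)^{−4/3}·I(1/3)²`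
(`0 < r² ≤ 1`, `0 < p ≤ 1`; reused by part VIII). [folklore] -/
theorem lintegral_rateΦA_inner_le {p r : ℝ} (hr : 0 < r) (hr1 : r ^ 2 ≤ 1) (hp : 0 < p) (hp1 : p ≤ 1) :
    ∫⁻ u : (ℝ × ℝ) × ((ℝ × ℝ) × (ℝ × ℝ)), sqBox.indicator (fun _ => (1 : ℝ≥0∞)) u.1 * (gqW p r u.1 u.2.1 * gqW p r u.1 u.2.2) ≤
      ENNReal.ofReal (16 * ((r ^ 2) ^ (-p)) ^ 2) * (ENNReal.ofReal (Real.pi ^ 2 / 48 * (r ^ 2) ^ (-(4/3 : ℝ))) * (Ising (1/3) * Ising (1/3))) := by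
  have hmeas : Measurable fun u : (ℝ × ℝ) × ((ℝ × ℝ) × (ℝ × ℝ)) => sqBox.indicator (fun _ => (1 : ℝ≥0∞)) u.1 * (gqW p r u.1 u.2.1 * gqW p r u.1 u.2.2) := by
    have hi : Measurable fun p : ℝ × ℝ => sqBox.indicator (fun _ => (1 : ℝ≥0∞)) p := measurable_const.indicator measurableSet_sqBox
    exact (hi.comp measurable_fst).mul ((( measurable_gqW p r).comp (measurable_fst.prodMk (measurable_fst.comp measurable_snd))).mul
      ((measurable_gqW p r).comp (measurable_fst.prodMk (measurable_snd.comp measurable_snd))))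
  rw [lintegral_volume_prod _ hmeas]
  have hin : ∀ q : ℝ × ℝ, ∫⁻ v : (ℝ × ℝ) × (ℝ × ℝ), sqBox.indicator (fun _ => (1 : ℝ≥0∞)) q * (gqW p r q v.1 * gqW p r q v.2) =
      sqBox.indicator (fun _ => (1 : ℝ≥0∞)) q * ((∫⁻ w, gqW p r q w) * (∫⁻ w, gqW p r q w)) := by
    intro q
    have hm : Measurable fun v : (ℝ × ℝ) × (ℝ × ℝ) => gqW p r q v.1 * gqW p r q v.2 :=
      ((measurable_gqW_right _ r q).comp measurable_fst).mul ((measurable_gqW_right _ r q).comp measurable_snd)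
    rw [lintegral_const_mul _ hm, lintegral_volume_prod_mul (measurable_gqW_right _ r q) (measurable_gqW_right _ r q)]
  simp_rw [hin]
  calc ∫⁻ q : ℝ × ℝ, sqBox.indicator (fun _ => (1 : ℝ≥0∞)) q * ((∫⁻ w, gqW p r q w) * (∫⁻ w, gqW p r q w))
      ≤ ∫⁻ q : ℝ × ℝ, ENNReal.ofReal (16 * ((r ^ 2) ^ (-p)) ^ 2) * (ENNReal.ofReal (Real.pi ^ 2 / 48 * (r ^ 2) ^ (-(4/3 : ℝ))) *
          ({u : ℝ | u ^ 2 < 1}.indicator (singPow (1/3)) q.1 * {u : ℝ | u ^ 2 < 1}.indicator (singPow (1/3)) q.2)) := by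
        refine lintegral_mono fun q => ?_
        by_cases hq : q ∈ sqBox
        · rw [indicator_of_mem hq, one_mul, indicator_of_mem hq.1, indicator_of_mem hq.2]
          exact (lintegral_gqW_sq_le hr hr1 hp hp1 q).trans (mul_le_mul' le_rfl (gaussSq_le_sing hr q.1 q.2))
        · rw [indicator_of_notMem hq, zero_mul]; exact bot_le
    _ = _ := by
        have hm' : Measurable fun q : ℝ × ℝ =>
            {u : ℝ | u ^ 2 < 1}.indicator (singPow (1/3)) q.1 * {u : ℝ | u ^ 2 < 1}.indicator (singPow (1/3)) q.2 :=
          ((measurable_boxSing _).comp measurable_fst).mul ((measurable_boxSing _).comp measurable_snd)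
        rw [lintegral_const_mul _ (hm'.const_mul _), lintegral_const_mul _ hm',
          lintegral_volume_prod_mul (measurable_boxSing _) (measurable_boxSing _)]
        rfl

/-- ★★ `∫ rateΦA ≤ s^θ20^θ · I(2θ)² · 16(r²)^{−6θ} · (π²/48)(r²)^{−4/3} · I(1/3)²` (`0 < r² ≤ 1`, `0 < θ`, `3θ ≤ 1`). [folklore] -/
theorem lintegral_rateΦA_le {s θ r : ℝ} (hr : 0 < r) (hr1 : r ^ 2 ≤ 1) (hθ : 0 < θ) (hθ1 : 3 * θ ≤ 1) :
    ∫⁻ w, rateΦA s θ r w ≤ ENNReal.ofReal (s ^ θ * 20 ^ θ) * ((Ising (2 * θ) * Ising (2 * θ)) *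
      (ENNReal.ofReal (16 * ((r ^ 2) ^ (-(3 * θ))) ^ 2) * (ENNReal.ofReal (Real.pi ^ 2 / 48 * (r ^ 2) ^ (-(4/3 : ℝ))) *
        (Ising (1/3) * Ising (1/3))))) := by
  have hmid := lintegral_rateΦA_inner_le hr hr1 (by positivity : 0 < 3 * θ) hθ1
  -- outer `(x₀, y₀)` factor
  have hmb : Measurable (boxSing (2 * θ)) := measurable_boxSing _
  have hlong : ∫⁻ p : ℝ × ℝ, boxSing (2 * θ) p.1 * boxSing (2 * θ) p.2 = Ising (2 * θ) * Ising (2 * θ) := by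
    rw [lintegral_volume_prod_mul hmb hmb]; rfl
  have hmeas : Measurable fun w : (ℝ × ℝ) × ((ℝ × ℝ) × ((ℝ × ℝ) × (ℝ × ℝ))) => (boxSing (2 * θ) w.1.1 * boxSing (2 * θ) w.1.2) *
      (sqBox.indicator (fun _ => (1 : ℝ≥0∞)) w.2.1 * (gqW (3 * θ) r w.2.1 w.2.2.1 * gqW (3 * θ) r w.2.1 w.2.2.2)) :=
    ((measurable_rateΦA_long θ).comp measurable_fst).mul ((measurable_rateΦA_inner θ r).comp measurable_snd)
  unfold rateΦA
  rw [lintegral_const_mul _ hmeas, lintegral_volume_prod_mul (measurable_rateΦA_long θ) (measurable_rateΦA_inner θ r), hlong]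
  exact mul_le_mul' le_rfl (mul_le_mul' le_rfl hmid)

/-- `Δ₁` is jointly measurable. [folklore] -/
theorem measurable_rateΔ₁_uncurry (s θ r : ℝ) : Measurable fun z : ℍ × ℍ => rateΔ₁ s θ r z.1 z.2 := by
  have hS : MeasurableSet {x : ℍ | x.re ^ 2 + x.imI ^ 2 < 1} := measurableSet_lt (by fun_prop) measurable_const
  have hg : Measurable fun z : ℍ × ℍ => gexp r z.1 z.2 := by
    have : (fun z : ℍ × ℍ => gexp r z.1 z.2) = fun z => 4 * (r ^ 2 * (z.1.imJ ^ 2 + z.1.imK ^ 2 + z.2.imJ ^ 2 + z.2.imK ^ 2) +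
        ((z.1.imK * z.2.imI - z.1.imI * z.2.imK) ^ 2 + (z.1.imI * z.2.imJ - z.1.imJ * z.2.imI) ^ 2)) := by
      funext z; rw [gexp_def]
    rw [this]; fun_prop
  have hR : Measurable fun z : ℍ × ℍ => rateR z.1 z.2 := by
    have : (fun z : ℍ × ℍ => rateR z.1 z.2) = fun z => 20 * (1 + (z.1.imJ ^ 2 + z.1.imK ^ 2 + z.2.imJ ^ 2 + z.2.imK ^ 2)) ^ 3 /
        ((z.1.re ^ 2 + z.1.imI ^ 2) ^ 2 * (z.2.re ^ 2 + z.2.imI ^ 2) ^ 2) := by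
      funext z; rw [rateR_def]
    rw [this]
    exact Measurable.div (by fun_prop) (by fun_prop)
  have e : (fun z : ℍ × ℍ => rateΔ₁ s θ r z.1 z.2) = fun z => ({x : ℍ | x.re ^ 2 + x.imI ^ 2 < 1}.indicator (fun _ => (1 : ℝ≥0∞)) z.1) *
      ({y : ℍ | y.re ^ 2 + y.imI ^ 2 < 1}.indicator (fun _ => (1 : ℝ≥0∞)) z.2) *
      ENNReal.ofReal (Real.exp (-(gexp r z.1 z.2)) * (s * rateR z.1 z.2) ^ θ) := by
    funext z; rw [rateΔ₁_def]
  rw [e]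
  exact (((measurable_const.indicator hS).comp measurable_fst).mul ((measurable_const.indicator hS).comp measurable_snd)).mul
    (ENNReal.measurable_ofReal.comp ((Real.measurable_exp.comp hg.neg).mul ((measurable_const.mul hR).pow_const _)))

/-- ★★ **THE INTEGRAL OF THE RATE TERM `Δ₁`**: for `0 ≤ s`, `0 < r² ≤ 1`, `0 < θ`, `3θ ≤ 1`,
`∫∫ Δ₁ ≤ s^θ20^θ·I(2θ)²·16(r²)^{−6θ}·(π²/48)(r²)^{−4/3}·I(1/3)²` (finite when `4θ < 1`). [folklore] -/
theorem lintegral_rateΔ₁_le {s θ r : ℝ} (hs : 0 ≤ s) (hr : 0 < r) (hr1 : r ^ 2 ≤ 1) (hθ : 0 < θ) (hθ1 : 3 * θ ≤ 1) :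
    ∫⁻ z, rateΔ₁ s θ r z.1 z.2 ∂((volume : Measure ℍ).prod volume) ≤
      ENNReal.ofReal (s ^ θ * 20 ^ θ) * ((Ising (2 * θ) * Ising (2 * θ)) *
        (ENNReal.ofReal (16 * ((r ^ 2) ^ (-(3 * θ))) ^ 2) * (ENNReal.ofReal (Real.pi ^ 2 / 48 * (r ^ 2) ^ (-(4/3 : ℝ))) *
          (Ising (1/3) * Ising (1/3))))) := by
  calc ∫⁻ z, rateΔ₁ s θ r z.1 z.2 ∂((volume : Measure ℍ).prod volume)
      ≤ ∫⁻ z, rateΦA s θ r (pairCoord z) ∂((volume : Measure ℍ).prod volume) := lintegral_mono fun z => rateΔ₁_le_rateΦA hs hθ.le r z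
    _ = ∫⁻ w, rateΦA s θ r w := measurePreserving_pairCoord.lintegral_comp (measurable_rateΦA s θ r)
    _ ≤ _ := lintegral_rateΦA_le hr hr1 hθ hθ1

end Summit.QuantumFields.YangMills.Theorems.SwapVirialDeficit.ZeroModeGroup

end
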